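import Literature.Barriers.CriticalPhenomena.PlanarEdwardsModelDiffusiveSILTScaling
import HarnessLib

/-!
# Mollified self-intersection local time: independence of the two halves
# (towards the exponential moments, Varadhan's renormalisation part (ii))

Sibling file of `Literature.Barriers.CriticalPhenomena.PlanarEdwardsModelDiffusive`. For a planar
Brownian motion `Z` (`Literature.Probability.Process.IsBrownianComplex`) with measurable marginals
and continuous paths, the mollified self-intersection local times of the two rescaled halves
`Edwards2D.halfScale Z` (a functional of `(Z_t)_{t ≤ ½}`) and `Edwards2D.halfShiftScale Z` (a
functional of the increments `(Z_{½+t} - Z_½)_{t ≥ 0}`) are **independent**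
(`indepFun_mollifiedSILT_halves`; Le Gall 1994, fact (i): "the variables `α(Aⁿ₁), …, α(Aⁿ_{2ⁿ⁻¹})`
are independent"). Ingredients:

* Mathlib's weak Markov property `IsPreBrownianReal.indepFun_shift` for each coordinate and the
  independence of the two coordinates, combined by the elementary `indepFun_pair_of_pair`
  (if `A ⟂ B`, `f₁(A) ⟂ f₂(A)` and `g₁(B) ⟂ g₂(B)` then `(f₁(A), g₁(B)) ⟂ (f₂(A), g₂(B))`;
  π-system argument);
* measurability of `T_k` with respect to the σ-algebra generated by the (stopped) past,
  resp. by the future increments: the joint-measurability lemma `Edwards2D.measurable_mollifiedSILT`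
  instantiated with these sub-σ-algebras on `Ω`.

## References

* J.-F. Le Gall, Sém. Prob. XXVIII, LNM 1583 (1994), 172–180, fact (i) after (5).
* O. Kallenberg, *Foundations of Modern Probability* (2002), Thm 13.5 (the shifted Brownian motion
  is independent of the past). [folklore]
-/

noncomputable section

open MeasureTheory ProbabilityTheory Real Filter Set Function
open scoped NNReal ENNReal Topology

namespace Literature.Barriers.CriticalPhenomena

namespace Edwards2D

open Literature.Probability.Process

universe u

/-! ### An elementary independence lemma -/

/-- **Pairing across independent sources.** If `A ⟂ B`, `f₁ ∘ A ⟂ f₂ ∘ A` and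
`g₁ ∘ B ⟂ g₂ ∘ B` (all maps measurable) then `(f₁ ∘ A, g₁ ∘ B) ⟂ (f₂ ∘ A, g₂ ∘ B)`: both sides of
the product formula on measurable rectangles equal
`P(f₁A ∈ ·) P(f₂A ∈ ·) P(g₁B ∈ ·) P(g₂B ∈ ·)`. Kallenberg (2002), Lemma 3.10. [folklore] -/
theorem indepFun_pair_of_pair {Ω α β γ₁ γ₂ δ₁ δ₂ : Type*} {mΩ : MeasurableSpace Ω}
    [MeasurableSpace α] [MeasurableSpace β] [MeasurableSpace γ₁] [MeasurableSpace γ₂]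
    [MeasurableSpace δ₁] [MeasurableSpace δ₂] {P : Measure Ω} [IsProbabilityMeasure P]
    {A : Ω → α} {B : Ω → β} (hAB : IndepFun A B P) (hA : Measurable A) (hB : Measurable B)
    {f₁ : α → γ₁} {f₂ : α → γ₂} {g₁ : β → δ₁} {g₂ : β → δ₂} (hf₁ : Measurable f₁)
    (hf₂ : Measurable f₂) (hg₁ : Measurable g₁) (hg₂ : Measurable g₂)
    (hf : IndepFun (f₁ ∘ A) (f₂ ∘ A) P) (hg : IndepFun (g₁ ∘ B) (g₂ ∘ B) P) :
    IndepFun (fun ω => (f₁ (A ω), g₁ (B ω))) (fun ω => (f₂ (A ω), g₂ (B ω))) P := by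
  have hX : Measurable fun ω => (f₁ (A ω), g₁ (B ω)) := (hf₁.comp hA).prodMk (hg₁.comp hB)
  have hY : Measurable fun ω => (f₂ (A ω), g₂ (B ω)) := (hf₂.comp hA).prodMk (hg₂.comp hB)
  set p₁ : Set (Set (γ₁ × δ₁)) := image2 (· ×ˢ ·) {s | MeasurableSet s} {t | MeasurableSet t}
  set p₂ : Set (Set (γ₂ × δ₂)) := image2 (· ×ˢ ·) {s | MeasurableSet s} {t | MeasurableSet t}
  have hπ₁ : IsPiSystem p₁ :=
    MeasurableSpace.isPiSystem_measurableSet.prod MeasurableSpace.isPiSystem_measurableSet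
  have hπ₂ : IsPiSystem p₂ :=
    MeasurableSpace.isPiSystem_measurableSet.prod MeasurableSpace.isPiSystem_measurableSet
  have hgen₁ : MeasurableSpace.comap (fun ω => (f₁ (A ω), g₁ (B ω))) Prod.instMeasurableSpace =
      MeasurableSpace.generateFrom {s | ∃ t ∈ p₁, (fun ω => (f₁ (A ω), g₁ (B ω))) ⁻¹' t = s} := by
    rw [← generateFrom_prod, MeasurableSpace.comap_generateFrom]
    rfl
  have hgen₂ : MeasurableSpace.comap (fun ω => (f₂ (A ω), g₂ (B ω))) Prod.instMeasurableSpace =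
      MeasurableSpace.generateFrom {s | ∃ t ∈ p₂, (fun ω => (f₂ (A ω), g₂ (B ω))) ⁻¹' t = s} := by
    rw [← generateFrom_prod, MeasurableSpace.comap_generateFrom]
    rfl
  rw [IndepFun_iff_Indep]
  refine IndepSets.indep hX.comap_le hY.comap_le (hπ₁.comap _) (hπ₂.comap _) hgen₁ hgen₂ ?_
  rw [IndepSets_iff]
  rintro _ _ ⟨_, ⟨s, hs, t, ht, rfl⟩, rfl⟩ ⟨_, ⟨u, hu, v, hv, rfl⟩, rfl⟩
  simp only [mem_setOf_eq] at hs ht hu hv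
  -- rewrite all events through `A` and `B`
  have e1 : (fun ω => (f₁ (A ω), g₁ (B ω))) ⁻¹' s ×ˢ t ∩ (fun ω => (f₂ (A ω), g₂ (B ω))) ⁻¹' u ×ˢ v =
      A ⁻¹' (f₁ ⁻¹' s ∩ f₂ ⁻¹' u) ∩ B ⁻¹' (g₁ ⁻¹' t ∩ g₂ ⁻¹' v) := by
    ext ω; simp only [mem_inter_iff, mem_preimage, mem_prod]; tauto
  have e2 : (fun ω => (f₁ (A ω), g₁ (B ω))) ⁻¹' s ×ˢ t = A ⁻¹' (f₁ ⁻¹' s) ∩ B ⁻¹' (g₁ ⁻¹' t) := by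
    ext ω; simp only [mem_inter_iff, mem_preimage, mem_prod]
  have e3 : (fun ω => (f₂ (A ω), g₂ (B ω))) ⁻¹' u ×ˢ v = A ⁻¹' (f₂ ⁻¹' u) ∩ B ⁻¹' (g₂ ⁻¹' v) := by
    ext ω; simp only [mem_inter_iff, mem_preimage, mem_prod]
  have e4 : A ⁻¹' (f₁ ⁻¹' s ∩ f₂ ⁻¹' u) = (f₁ ∘ A) ⁻¹' s ∩ (f₂ ∘ A) ⁻¹' u := by
    ext ω; simp
  have e5 : B ⁻¹' (g₁ ⁻¹' t ∩ g₂ ⁻¹' v) = (g₁ ∘ B) ⁻¹' t ∩ (g₂ ∘ B) ⁻¹' v := by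
    ext ω; simp
  rw [e1, e2, e3, hAB.measure_inter_preimage_eq_mul _ _ ((hf₁ hs).inter (hf₂ hu)) ((hg₁ ht).inter (hg₂ hv)),
    hAB.measure_inter_preimage_eq_mul _ _ (hf₁ hs) (hg₁ ht),
    hAB.measure_inter_preimage_eq_mul _ _ (hf₂ hu) (hg₂ hv), e4, e5,
    hf.measure_inter_preimage_eq_mul _ _ hs hu, hg.measure_inter_preimage_eq_mul _ _ ht hv]
  simp only [Set.preimage_comp]
  ring

/-! ### Past and future of a planar Brownian motion at time `½` -/

variable {Ω : Type u} {Z : ℝ≥0 → Ω → ℂ}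

/-- The pair (past of the real part, past of the imaginary part) up to time `½`. [folklore] -/
def pastPair (Z : ℝ≥0 → Ω → ℂ) (ω : Ω) : (Set.Iic (1 / 2 : ℝ≥0) → ℝ) × (Set.Iic (1 / 2 : ℝ≥0) → ℝ) :=
  (fun t => (Z t ω).re, fun t => (Z t ω).im)

/-- The pair (future increments of the real part, of the imaginary part) after time `½`.
[folklore] -/
def futurePair (Z : ℝ≥0 → Ω → ℂ) (ω : Ω) : (ℝ≥0 → ℝ) × (ℝ≥0 → ℝ) :=
  (fun t => (Z (1 / 2 + t) ω).re - (Z (1 / 2) ω).re, fun t => (Z (1 / 2 + t) ω).im - (Z (1 / 2) ω).im)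

section PastFuture

variable [MeasurableSpace Ω] {P : Measure Ω}

/-- `pastPair` is measurable. [folklore] -/
theorem measurable_pastPair (hmeas : ∀ t, Measurable (Z t)) : Measurable (pastPair Z) := by
  refine Measurable.prodMk ?_ ?_
  · exact measurable_pi_lambda _ fun t => Complex.measurable_re.comp (hmeas t)
  · exact measurable_pi_lambda _ fun t => Complex.measurable_im.comp (hmeas t)

/-- `futurePair` is measurable. [folklore] -/
theorem measurable_futurePair (hmeas : ∀ t, Measurable (Z t)) : Measurable (futurePair Z) := by
  refine Measurable.prodMk ?_ ?_
  · exact measurable_pi_lambda _ fun t =>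
      (Complex.measurable_re.comp (hmeas _)).sub (Complex.measurable_re.comp (hmeas _))
  · exact measurable_pi_lambda _ fun t =>
      (Complex.measurable_im.comp (hmeas _)).sub (Complex.measurable_im.comp (hmeas _))

/-- **The past and the future increments of a planar Brownian motion are independent** (Mathlib's
weak Markov property `IsPreBrownianReal.indepFun_shift` for each coordinate, paired across the
two independent coordinates). Kallenberg (2002), Thm 13.5. [folklore] -/
theorem indepFun_pastPair_futurePair [IsProbabilityMeasure P] (hZ : IsBrownianComplex Z P)
    (hmeas : ∀ t, Measurable (Z t)) : IndepFun (pastPair Z) (futurePair Z) P := by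
  -- the full real and imaginary paths
  set A : Ω → (ℝ≥0 → ℝ) := fun ω t => (Z t ω).re
  set B : Ω → (ℝ≥0 → ℝ) := fun ω t => (Z t ω).im
  have hA : Measurable A := measurable_pi_lambda _ fun t => Complex.measurable_re.comp (hmeas t)
  have hB : Measurable B := measurable_pi_lambda _ fun t => Complex.measurable_im.comp (hmeas t)
  -- restriction to the past and the future-increment functional on path space
  set πp : (ℝ≥0 → ℝ) → (Set.Iic (1 / 2 : ℝ≥0) → ℝ) := fun p t => p t
  set πf : (ℝ≥0 → ℝ) → (ℝ≥0 → ℝ) := fun p t => p (1 / 2 + t) - p (1 / 2)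
  have hπp : Measurable πp := measurable_pi_lambda _ fun t => measurable_pi_apply _
  have hπf : Measurable πf := measurable_pi_lambda _ fun t =>
    (measurable_pi_apply _).sub (measurable_pi_apply _)
  have hfA : IndepFun (πp ∘ A) (πf ∘ A) P := (hZ.re.toIsPreBrownianReal.indepFun_shift (1 / 2)).symm
  have hfB : IndepFun (πp ∘ B) (πf ∘ B) P := (hZ.im.toIsPreBrownianReal.indepFun_shift (1 / 2)).symm
  exact indepFun_pair_of_pair hZ.indepFun hA hB hπp hπf hπp hπf hfA hfB

end PastFuture

/-! ### Measurability of the two halves' functionals w.r.t. past and future -/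

/-- The mollified self-intersection local time only depends on the path on `[0,1]`. [folklore] -/
theorem mollifiedSILT_congr {Z Z' : ℝ≥0 → Ω → ℂ} (h : ∀ t ≤ 1, Z t = Z' t) (k : ℕ) :
    mollifiedSILT Z k = mollifiedSILT Z' k := by
  funext ω
  unfold mollifiedSILT
  refine setIntegral_congr_fun measurableSet_Icc fun s hs => ?_
  refine setIntegral_congr_fun measurableSet_Icc fun t ht => ?_
  have hs1 : s.toNNReal ≤ 1 := Real.toNNReal_le_one.2 hs.2
  have ht1 : t.toNNReal ≤ 1 := Real.toNNReal_le_one.2 ht.2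
  simp only [h _ hs1, h _ ht1]

/-- The first rescaled half, stopped at time `1`: `t ↦ √2 Z_{(t ∧ 1)/2}` — a functional of the
past up to time `½`, with continuous paths, agreeing with `halfScale Z` on `[0,1]`. [folklore] -/
def halfScaleStopped (Z : ℝ≥0 → Ω → ℂ) (t : ℝ≥0) (ω : Ω) : ℂ := halfScale Z (min t 1) ω

/-- The stopped half agrees with `halfScale Z` on `[0,1]`. [folklore] -/
theorem halfScaleStopped_eq {t : ℝ≥0} (ht : t ≤ 1) : halfScaleStopped Z t = halfScale Z t := by
  funext ω
  simp [halfScaleStopped, min_eq_left ht]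

/-- The stopped half has continuous paths. [folklore] -/
theorem continuous_halfScaleStopped (hcont : ∀ ω, Continuous (Z · ω)) (ω : Ω) :
    Continuous (halfScaleStopped Z · ω) :=
  (continuous_halfScale hcont ω).comp (continuous_id.min continuous_const)

/-- Each marginal of the stopped half is measurable w.r.t. the σ-algebra generated by the past
pair. [folklore] -/
theorem measurable_halfScaleStopped_comap (t : ℝ≥0) :
    Measurable[MeasurableSpace.comap (pastPair Z) inferInstance] (halfScaleStopped Z t) := by
  have ht : min t 1 / 2 ∈ Set.Iic (1 / 2 : ℝ≥0) := by
    rw [Set.mem_Iic]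
    have : min t 1 ≤ 1 := min_le_right t 1
    calc min t 1 / 2 ≤ 1 / 2 := by gcongr
      _ = 1 / 2 := rfl
  -- the functional on the past pair
  set φ : (Set.Iic (1 / 2 : ℝ≥0) → ℝ) × (Set.Iic (1 / 2 : ℝ≥0) → ℝ) → ℂ :=
    fun pq => (Real.sqrt 2 : ℂ) * ((pq.1 ⟨min t 1 / 2, ht⟩ : ℂ) + (pq.2 ⟨min t 1 / 2, ht⟩ : ℂ) * Complex.I)
  have hφ : Measurable φ := by
    refine measurable_const.mul (Measurable.add ?_ (Measurable.mul ?_ measurable_const))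
    · exact Complex.measurable_ofReal.comp ((measurable_pi_apply _).comp measurable_fst)
    · exact Complex.measurable_ofReal.comp ((measurable_pi_apply _).comp measurable_snd)
  have heq : halfScaleStopped Z t = φ ∘ pastPair Z := by
    funext ω
    simp only [halfScaleStopped, halfScale, pastPair, Function.comp_apply, φ]
    congr 1
    exact (Complex.re_add_im _).symm
  rw [heq]
  exact hφ.comp (Measurable.of_comap_le le_rfl)

/-- Each marginal of the second rescaled half is measurable w.r.t. the σ-algebra generated by the
future-increment pair. [folklore] -/
theorem measurable_halfShiftScale_comap (t : ℝ≥0) :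
    Measurable[MeasurableSpace.comap (futurePair Z) inferInstance] (halfShiftScale Z t) := by
  set φ : (ℝ≥0 → ℝ) × (ℝ≥0 → ℝ) → ℂ :=
    fun pq => (Real.sqrt 2 : ℂ) * ((pq.1 (t / 2) : ℂ) + (pq.2 (t / 2) : ℂ) * Complex.I)
  have hφ : Measurable φ := by
    refine measurable_const.mul (Measurable.add ?_ (Measurable.mul ?_ measurable_const))
    · exact Complex.measurable_ofReal.comp ((measurable_pi_apply _).comp measurable_fst)
    · exact Complex.measurable_ofReal.comp ((measurable_pi_apply _).comp measurable_snd)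
  have heq : halfShiftScale Z t = φ ∘ futurePair Z := by
    funext ω
    simp only [halfShiftScale, futurePair, Function.comp_apply, φ]
    congr 1
    rw [← Complex.sub_re, ← Complex.sub_im]
    exact (Complex.re_add_im _).symm
  rw [heq]
  exact hφ.comp (Measurable.of_comap_le le_rfl)

/-- `T_k(halfScale Z)` is measurable w.r.t. the past σ-algebra (joint measurability of the kernel
process, `Edwards2D.measurable_mollifiedSILT`, over the sub-σ-algebra). [folklore] -/
theorem measurable_mollifiedSILT_halfScale_comap (hcont : ∀ ω, Continuous (Z · ω)) (k : ℕ) :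
    Measurable[MeasurableSpace.comap (pastPair Z) inferInstance] (mollifiedSILT (halfScale Z) k) := by
  rw [← mollifiedSILT_congr (fun t ht => halfScaleStopped_eq ht) k]
  exact @measurable_mollifiedSILT Ω (halfScaleStopped Z) (MeasurableSpace.comap (pastPair Z) inferInstance)
    (fun t => measurable_halfScaleStopped_comap t) (continuous_halfScaleStopped hcont) k

/-- `T_k(halfShiftScale Z)` is measurable w.r.t. the future-increment σ-algebra. [folklore] -/
theorem measurable_mollifiedSILT_halfShiftScale_comap (hcont : ∀ ω, Continuous (Z · ω)) (k : ℕ) :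
    Measurable[MeasurableSpace.comap (futurePair Z) inferInstance] (mollifiedSILT (halfShiftScale Z) k) :=
  @measurable_mollifiedSILT Ω (halfShiftScale Z) (MeasurableSpace.comap (futurePair Z) inferInstance)
    (fun t => measurable_halfShiftScale_comap t) (continuous_halfShiftScale hcont) k

section Main

variable [MeasurableSpace Ω] {P : Measure Ω}

/-- **Independence of the two halves' self-intersection functionals** (Le Gall 1994, fact (i)):
`T_k(halfScale Z) ⟂ T_k(halfShiftScale Z)` for a planar Brownian motion `Z` with measurable
marginals and continuous paths. [cite: LeGall1994, fact (i) after (5)] -/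
theorem indepFun_mollifiedSILT_halves [IsProbabilityMeasure P] (hZ : IsBrownianComplex Z P)
    (hmeas : ∀ t, Measurable (Z t)) (hcont : ∀ ω, Continuous (Z · ω)) (k l : ℕ) :
    IndepFun (mollifiedSILT (halfScale Z) k) (mollifiedSILT (halfShiftScale Z) l) P := by
  have h := indepFun_pastPair_futurePair hZ hmeas
  rw [IndepFun_iff_Indep] at h ⊢
  refine indep_of_indep_of_le_right (indep_of_indep_of_le_left h ?_) ?_
  · exact (measurable_mollifiedSILT_halfScale_comap hcont k).comap_le
  · exact (measurable_mollifiedSILT_halfShiftScale_comap hcont l).comap_le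

end Main

end Edwards2D

end Literature.Barriers.CriticalPhenomena
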